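import Mathlib
import HarnessLib
import Summits.CriticalPhenomena.SAWScalingLimit.Theses.SAWDevelopingMap
import Summits.CriticalPhenomena.SAWScalingLimit.Theses.SAWHexUniversality
import Summits.CriticalPhenomena.SAWScalingLimit.Theses.SAWBrickWallHomotopy
import Summits.CriticalPhenomena.SAWScalingLimit.Theorems.ObservableToSLE.Negative.Identification
import Summits.CriticalPhenomena.SAWScalingLimit.Theorems.SAWDevelopingMapHexConjectureMarginalWedgeDefs
import Summits.CriticalPhenomena.SAWScalingLimit.Theorems.SAWDevelopingMapHexConjectureReflexWedgeGeometry
import Summits.CriticalPhenomena.SAWScalingLimit.Theorems.SAWDevelopingMapHexConjectureReflexFluxLine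
import Summits.CriticalPhenomena.SAWScalingLimit.Theorems.SAWDevelopingMapHexConjectureConeExteriorEscape
import Summits.CriticalPhenomena.SAWScalingLimit.Theorems.SAWDevelopingMapHexConjectureHexTightOfTraversalBound
import Summits.CriticalPhenomena.SAWScalingLimit.Theorems.SAWDevelopingMapHexConjectureReflexCellCeilingRays
import Summits.CriticalPhenomena.SAWScalingLimit.Theorems.SAWDevelopingMapHexConjectureArcPhases
import Literature.Probability.RandomPlanarGeometry.HexParafermion
import Literature.Probability.RandomPlanarGeometry.HexSAW
import Literature.Probability.RandomPlanarGeometry.CurveTortuosity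
import Literature.Probability.RandomPlanarGeometry.SLEConvergenceCriterion
import Literature.Barriers.CriticalPhenomena.ParafermionicHalfCauchyRiemann

/-!
# Line `marginal-reflex-wedge-cauchy-kernel` — skeleton for crux `HexConjecture` (stmt-CriticalPhenomena-0808)

Crux (lead route `SAWDevelopingMap`; decl shared verbatim by `SAWHexUniversality`,
`SAWBrickWallHomotopy`; `SAWDefectDecoherence` dropped its copy but keeps `HexTight`): `HexConjecture` = Duminil-Copin–Smirnov 2012 Conjecture 1 on the honeycomb
lattice — for every Dobrushin domain and hexagonal endpoint approximation the critical SAW law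
`hexSAWLaw`, pushed to `CurveClass ℂ`, converges to chordal SLE(8/3).

Idea (card `Ideas/marginal-reflex-wedge-cauchy-kernel.md`, triage r1-1/2/3 pass): MARGINAL GEOMETRY.
Summing DCS Lemma 1 (PROVED in the tree, `DuminilCopinSmirnov2012_lemma1_holds`) over the truncated
300° lattice wedge `W_N = {v : ‖c_v‖ < N, arg c_v ∉ [0, π/3]}` rooted at the corner mid-edge
`a = cornerEdge` (on the 0°-ray, `F(a) = 1`), the two rays carry OPPOSITE rigid phases `e^{-iπ/8}`,
`e^{+i7π/8}` (lifted normals differ by `-8π/3`, times `1 - σ = 3/8`), so the Green identity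
`hexFlux W_N F = 0` collapses to the FLUX LINE
  `Σ_arc (z - v_z) F(z) = (1/(2√3)) · (-i - e^{-iπ/8} (Z₀ - Z₆₀))`        (stub 1),
whence `Σ_{arc of W_N} Z_Λ(a → z) ≥ cos(π/8)` for EVERY finite `Λ ⊇ W_N`, every `N ≥ 1`
(stub 2: the cone-exterior escape floor — a scale-free LOWER bound on critical SAW masses with no
surgery and no sub-exponential loss). The card's bet (T-side) is that this floor, paired with the
conjectured CEILING making the marginal cell dimensionless (stub 3: arc mass `O(1)`, ray masses
`O(log N)`), is the RSW-type two-sided cell that the missing tightness half of the crux needs: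
stub 4 (HARDEST, open) turns the two-sided cell into the Aizenman–Burchard multi-traversal bound for
`hexSAWLaw` (`HexTraversalBound`), stub 5 (in-tree technology: `isTightMeasureSet_of_traversalBounds`,
`isTightAlongMesh_of_isTightMeasureSet_image`) turns that into `HexTight`. The identification half
(stub 6, `HexTight → HexIdentification`: every subsequential limit law is the SLE(8/3) law) is NOT
attacked by this line — it is the target of the route's `HexObservableLimitR → ObservableToSLER` chain and of the
`ObservableToSLE` / restriction lines; the card's I-side contribution (the wedge as the one domain
where Conjecture 2's target is the Cauchy kernel `1/z` with lattice-exact Riemann–Hilbert phases and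
flux-pinned normalisation) is recorded in the line card as the cheapest falsifier, not as a stub.

LEAD'S RESHAPE (cycle 1, prover-line-stmt-CriticalPhenomena-0808-0): the planner's stub 1 is split into
`stub_reflexWedgeGeometry` (W_N hex-simply-connected, root on ∂W_N, geometry of the ray darts and the two
RIGID WINDING VALUES `+π` / `-5π/3`) and `stub_reflexFluxLine : ReflexWedgeGeometry → ReflexFluxLine`
(the Green bookkeeping), 7 stubs in all; every `stub_*` is stated UNFOLDED over the line's objects, which
live in ONE shared file `Theorems/SAWDevelopingMapHexConjectureMarginalWedgeDefs.lean` (namespace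
`…Theorems.HexConjecture.MarginalWedge`, landed p85842), so that stub
files under `Theorems/` restate the registered signatures textually.

STATUS after wave 1 (2026-08-16T10:30Z): FOUR stubs LANDED as `--supports` theorems and are plugged in below —
`stub_reflexWedgeGeometry` (p95759; helpers p95634/p95688/p95686), `stub_reflexFluxLine` (p88297),
`stub_coneExteriorEscape` (p88075), `stub_hexTight_of_traversalBound` (p88241); the ceiling worker landed the
REDUCTION `arcMass_le_of_arcPhases` (p87487: flux line + rigid arc-dart phases ⇒ arc mass ≤ 1 + √2) and
`rayMassDiff_le_of_arcPhases` (p89485: `|Z₀ − Z₆₀ − sin(π/8)| ≤ 1 + √2`). RESHAPE 2: the open ceiling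
`ReflexCellCeiling` is now DERIVED (`reflexCellCeiling_of`) from two new registered stubs — `stub_arcPhases`
(GEOMETRY, provable: every arc dart of `W_N` has direction `θ ∈ [−11π/6, π/6]` and rigid winding `θ + π/2`)
and `stub_rayCeiling` (OPEN: `Z₀ + Z₆₀ ≤ C(1 + log N)`) — so that the arc half of the two-sided cell
`cos(π/8) ≤ arc mass ≤ 1 + √2` becomes a theorem; `stub_traversalBound_of_reflexCell` and
`stub_identification_of_tight` keep their registered signatures. After wave 2 (`stub_arcPhases` LANDED) the open stubs are: rayCeiling (OPEN), traversalBound (the bet — line-dead, see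
`Lines/marginal-reflex-wedge-cauchy-kernel.dead.md`), identification (OPEN, external; = HexTight → HexConjecture, crux 10472/14005).
The two-sided arc cell `cos(π/8) ≤ Σ_arc Z ≤ 1 + √2` (`arcMass_mem_Icc`) is now an unconditional THEOREM.

The composition `HexConjecture_of` is sorry-free over the stubs and concludes the route decl BY
NAME through the landed soft half `convergesInLawToSLE_of_identification`
(`Theorems/ObservableToSLE/Negative/Identification.lean`: Prokhorov along the mesh, Dirac padding of
the junk-`0` laws, `IsSLECurve.map_eq_holds`).

Disproof used: `run/gate/evidence/stmt-CriticalPhenomena-0808/…-Disproof.lean` is not mounted in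
this jail (as for the three triagers); honoured instead the LANDED negatives
`Theorems/HexConjecture/Negative/LoadBearing.lean` (`hexConjecture_false_without_tendsto_fst/_snd/
_reachable`: every clause of `IsEmbEndpointApprox` is load-bearing — stubs 4–6 keep the full
hypothesis; stub 5 USES `reachable` for eventual probability and `tendsto_fst/_snd` for the compact
container), `NonVacuity.lean`, `BoundaryWitness.lean` (refuted strengthenings "probability measure
for all δ" and "fugacity 0" are not asserted: everything here is at `x_c` and eventual in `δ`).
Negatives index (0772 all-δ tightness, 8261, 8312, 5420 corridor witness): not touched — `HexTight`
is the eventual `IsTightAlongMesh` form, no observable normalisation point is used.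
-/

noncomputable section

open MeasureTheory Filter Topology Set
open scoped BigOperators NNReal ENNReal Classical
open Literature.Probability.LatticeModels hiding cornerEdge
open Literature.Probability.RandomPlanarGeometry
open Literature.Probability.RandomPlanarGeometry.SAW
open Literature.Barriers.CriticalPhenomena.HexGreen (nbrs)
open Summit.CriticalPhenomena.SAWScalingLimit.Theses.SAWDevelopingMap (HexConjecture HexTight)
open Summit.CriticalPhenomena.SAWScalingLimit.Theorems.ObservableToSLE.Negative
  (convergesInLawToSLE_of_identification)
open Summit.CriticalPhenomena.SAWScalingLimit.Theorems.HexConjecture.MarginalWedge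

namespace Summit.CriticalPhenomena.SAWScalingLimit.Cruxes.HexConjecture.MarginalReflexWedgeCauchyKernel

/-! ## Vocabulary of the line: the shared objects file
`Theorems/SAWDevelopingMapHexConjectureMarginalWedgeDefs.lean` (p85842, namespace
`Summit.CriticalPhenomena.SAWScalingLimit.Theorems.HexConjecture.MarginalWedge`, opened above): `cornerIn`,
`cornerOut`, `cornerEdge`, `InSector`, `IsReflexWedgeTruncation`, `dartSum`, `IsArcDart`, `IsRayZeroDart`,
`IsRaySixtyDart`, `Fc`, `Zm`, `farFlux`, `rayZeroMass`, `raySixtyMass`, `hexPolyline`, `mk_hexPolyline`. -/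

/-! ## The statements of the line (named `Prop`s, documentation + `LineShape`; the registered `stub_*`
theorems below restate them UNFOLDED, and the `*_holds` consistency lemmas check the two agree) -/

/-- STATEMENT G — GEOMETRY OF THE MARGINAL REFLEX CELL (lead's split of the planner's stub 1): for
every truncation `W_N`, `N ≥ 1`: (i) `W_N` is hex-simply-connected (connected complement: every
vertex off `W_N` has a neighbour off `W_N` of strictly larger `3A² + B²`, `c = A/2 + iB/(2√3)`, inside
the closed sector for sector vertices — up-faces step `+30°`, down-faces step `+90°` —, and the far
region `‖c‖ ≥ N` is connected); (ii) the root `cornerEdge ∈ ∂W_N` (`cornerIn ∈ W_N`, `cornerOut` in the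
sector); (iii) a `0°`-ray dart `(v, w)` is a VERTICAL edge, `c_w - c_v = i/√3` (`im c_v < 0 < im c_w`,
both `|im| ≥ 1/(2√3)`), and EVERY walk of `W_N` from the root to `s(v, w)` has winding `+π` (rigidity
`HexMidEdgeSAW.winding_eq_of_mem_boundary` + the explicit bottom zigzag
`cornerIn = D₀, U₁, D₁, …, Uₙ, Dₙ`, `Dₖ = ((k,-1),1)`, `Uₖ = ((k,-1),0)`, whose turns are
`+60, +60, (-60, +60)^{n-1}, +60`; or Hopf on the closed curve walk + axis segment, counter-clockwise);
(iv) a `60°`-ray dart has `c_w - c_v = e^{-iπ/6}/√3` (mirror image of (iii) in the `30°` line) and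
every walk from the root to it has winding `-5π/3` (explicit walk: around the apex hexagon
`D₀ → 270° → 210° → 150° → 90°` then the mirrored zigzag; turns `-60 ×4, (+60, -60)^{n}, -60`). -/
def ReflexWedgeGeometry : Prop :=
  ∀ (Λ : Finset HexVertex) (N : ℝ), 1 ≤ N → IsReflexWedgeTruncation Λ N →
    hexDomainSimplyConnected Λ ∧ cornerEdge ∈ hexDomainBoundary Λ ∧
    (∀ v w : HexVertex, v ∈ Λ → w ∉ Λ → hexGraph.Adj v w → IsRayZeroDart N v w →
      hexCenter w - hexCenter v = ((Real.sqrt 3)⁻¹ : ℝ) * Complex.I ∧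
      ∀ γ : HexMidEdgeSAW Λ cornerEdge s(v, w), γ.winding = Real.pi) ∧
    (∀ v w : HexVertex, v ∈ Λ → w ∉ Λ → hexGraph.Adj v w → IsRaySixtyDart N v w →
      hexCenter w - hexCenter v = ((Real.sqrt 3)⁻¹ : ℝ) * Complex.exp (-(Real.pi / 6) * Complex.I) ∧
      ∀ γ : HexMidEdgeSAW Λ cornerEdge s(v, w), γ.winding = -(5 * Real.pi / 3))

/-- STATEMENT 1 — the FLUX LINE of the marginal reflex cell (exact lattice identity at `x = x_c`,
`σ = 5/8`): for every truncation `W_N`, `N ≥ 1`, `Φ_N = (1/(2√3)) · (-i - e^{-iπ/8} · (Z₀ - Z₆₀))`.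
Content given STATEMENT G: DCS Lemma 1 summed over `W_N` (`hexFlux_eq_zero_of_satisfiesVertexRelations`
with `DuminilCopinSmirnov2012_lemma1_holds`, `lemma1_iff`; `hexCriticalFugacity = (√(2+√2))⁻¹` is `rfl`);
`hexFlux` splits over the boundary darts root ∪ ray-0 ∪ ray-60 ∪ arc (disjoint: `w ∉ W_N ⟺ ‖c_w‖ ≥ N ∨
InSector c_w`, and `v ∈ W_N` has `arg c_v < 0 ∨ π/3 < arg c_v`); the root dart contributes
`((c_out - c_in)/2)·F(a) = i/(2√3)` (`hexParafermionicObservable_self`); on a ray dart all walks have the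
same winding `W`, so `F = e^{-i(5/8)W}·Z` with `Z = ‖F‖` and the term `((c_w - c_v)/2)·F` equals
`(1/(2√3)) e^{-iπ/8} ‖F‖` (ray 0: `e^{iπ/2} e^{-i5π/8}`) resp. `(1/(2√3)) e^{i7π/8} ‖F‖ =
-(1/(2√3)) e^{-iπ/8} ‖F‖` (ray 60: `e^{-iπ/6} e^{i25π/24}`). Verified by exact enumeration to `1e-15`
for `N ≤ 3.5` by the ideator and all three triagers. -/
def ReflexFluxLine : Prop :=
  ∀ (Λ : Finset HexVertex) (N : ℝ), 1 ≤ N → IsReflexWedgeTruncation Λ N →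
    farFlux Λ N =
      (1 / (2 * Real.sqrt 3) : ℂ) *
        (-Complex.I -
          Complex.exp (-Complex.I * (Real.pi / 8)) * ((rayZeroMass Λ N - raySixtyMass Λ N : ℝ) : ℂ))

/-- STATEMENT 2 — the CONE-EXTERIOR ESCAPE FLOOR: for every finite vertex domain `Λ' ⊇ W_N`, the
`x_c`-masses from the corner root to the arc darts of `W_N` sum to at least `cos(π/8) ≈ 0.924`,
uniformly in `N ≥ 1`. From STATEMENT 1: the far flux lies on a line missing the origin by
`sin(5π/8) = cos(π/8)`, `‖(z - v_z)F‖ = (1/(2√3))‖F‖`, `‖F_{W_N}(z)‖ ≤ Z_{W_N}(a → z)`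
(`norm_hexParafermionicObservable_le`) and RESTRICTION MONOTONICITY `Z_{W_N} ≤ Z_{Λ'}`. -/
def ConeExteriorEscape : Prop :=
  ∀ (Λ Λ' : Finset HexVertex) (N : ℝ), 1 ≤ N → IsReflexWedgeTruncation Λ N → Λ ⊆ Λ' →
    Real.cos (Real.pi / 8) ≤ dartSum Λ (IsArcDart N) fun v w => Zm Λ' cornerEdge s(v, w)

/-- STATEMENT 3 — the CEILING making the marginal cell dimensionless (OPEN): one constant `C` bounds,
for every `N ≥ 1`, the arc mass of `W_N` from the corner (`≤ C`) and the two ray masses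
(`≤ C (1 + log N)`). With STATEMENT 2 this pins the far mass in `[cos(π/8), C]` at every scale. -/
def ReflexCellCeiling : Prop :=
  ∃ C : ℝ, ∀ (Λ : Finset HexVertex) (N : ℝ), 1 ≤ N → IsReflexWedgeTruncation Λ N →
    (dartSum Λ (IsArcDart N) fun v w => Zm Λ cornerEdge s(v, w)) ≤ C ∧
    (dartSum Λ (IsRayZeroDart N) fun v w => Zm Λ cornerEdge s(v, w)) +
        (dartSum Λ (IsRaySixtyDart N) fun v w => Zm Λ cornerEdge s(v, w)) ≤ C * (1 + Real.log N)

/-- STATEMENT 4/5 junction — the AIZENMAN–BURCHARD MULTI-TRAVERSAL BOUND for the critical hexagonal SAW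
(hypothesis (H1) of `isTightMeasureSet_of_traversalBounds`; round shells, a shell-dependent threshold
`k x ρ R`, small meshes). The law is the junk `0` when `a δ`, `b δ` are not joined (bound trivial). -/
def HexTraversalBound : Prop :=
  ∀ (D : DobrushinDomain) (a b : ℝ → HexVertex), IsEmbEndpointApprox hexGraph hexCenter D a b →
    ∃ (k : ℂ → ℝ → ℝ → ℕ) (K lam δ₀ : ℝ), 0 ≤ K ∧ 2 < lam ∧ 0 < δ₀ ∧
      ∀ δ ∈ Set.Ioc (0 : ℝ) δ₀, ∀ (x : ℂ) (ρ R : ℝ), δ ≤ ρ → ρ < R → R ≤ 1 →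
        hexSAWLaw D.carrier δ (a δ) (b δ)
            {γ | (hexPolyline γ).HasTraversals (k x ρ R) x ρ R} ≤
          ENNReal.ofReal (K * (ρ / R) ^ lam)

/-- STATEMENT 6's conclusion — IDENTIFICATION of subsequential limits (the I-half of the crux, exactly the
last hypothesis of the landed `convergesInLawToSLE_of_identification`). -/
def HexIdentification : Prop :=
  ∀ (D : DobrushinDomain) (a b : ℝ → HexVertex), IsEmbEndpointApprox hexGraph hexCenter D a b →
    ∀ μ : Measure (CurveClass ℂ), IsProbabilityMeasure μ →
      IsSubseqLimitLaw (fun δ (γ : HexDomainSAW D.carrier δ (a δ) (b δ)) => γ.curve)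
        (fun δ => hexSAWLaw D.carrier δ (a δ) (b δ)) μ →
      IsSLELaw ((8 : ℝ≥0) / 3) D μ

/-! ## Two more statements (RESHAPE 2): the ceiling split into its provable arc half and its open ray half -/

/-- STATEMENT P — ARC PHASES (geometry, provable): every arc dart `(v, w)` of `W_N` (`‖c_w‖ ≥ N`) points in a
lattice direction `θ` with `−11π/6 ≤ θ ≤ π/6` (the six directions `±π/6, ±π/2, ±5π/6` lifted to the branch
cut along the removed sector) and EVERY walk of `W_N` from the root to `s(v, w)` has the rigid winding
`θ + π/2` (initial direction `−π/2`; Hopf: seen from the phantom start `c_cornerOut` all vertices of `W_N`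
avoid the closed cone of directions `[0, π/3]`, seen from the outer vertex `c_w` (`‖c_w‖ ≥ N`) they lie in an
open half-plane, so both secant sweeps are single-valued — `HV.hopf_path` / `hopf_path_eval` in
`HexSAWHopfPath.lean`; verified by enumeration for `N ≤ 12`, extremes `θ = π/6` and `θ = −11π/6` attained).
Exactly the hypothesis of the landed `arcMass_le_of_arcPhases` (p87487). -/
def ArcPhases : Prop :=
  ∀ (Λ : Finset HexVertex) (N : ℝ), 1 ≤ N → IsReflexWedgeTruncation Λ N →
    ∀ v w : HexVertex, v ∈ Λ → w ∉ Λ → hexGraph.Adj v w → IsArcDart N v w →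
      ∃ θ : ℝ, -(11 * Real.pi / 6) ≤ θ ∧ θ ≤ Real.pi / 6 ∧
        hexCenter w - hexCenter v = ((Real.sqrt 3)⁻¹ : ℝ) * Complex.exp (θ * Complex.I) ∧
        ∀ γ : HexMidEdgeSAW Λ cornerEdge s(v, w), γ.winding = θ + Real.pi / 2

/-- STATEMENT R — RAY CEILING (OPEN; the logarithmic partner of the dimensionless cell): the two ray masses
of `W_N` from the corner are `O(log N)` (density `≍ 1/k` at distance `k`: corner weight `3/8` + boundary
weight `5/8` = `1`). SMC numerics: `Z₀/Z₆₀ = 0.17/0.09 (N = 2) → 0.45/0.22 (N = 6)`; jobs j016180–4 measure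
`N ≤ 32`. No in-tree tool bounds a corner-rooted boundary mass from above (worker verdict, wave 1). -/
def RayCeiling : Prop :=
  ∃ C : ℝ, ∀ (Λ : Finset HexVertex) (N : ℝ), 1 ≤ N → IsReflexWedgeTruncation Λ N →
    (dartSum Λ (IsRayZeroDart N) fun v w => Zm Λ cornerEdge s(v, w)) +
        (dartSum Λ (IsRaySixtyDart N) fun v w => Zm Λ cornerEdge s(v, w)) ≤ C * (1 + Real.log N)

/-! ## The stubs (`sorry` lives only in the OPEN ones; signatures UNFOLDED over the shared objects; the four
stubs closed in wave 1 are kept, under their registered names, as one-line references to the landed theorems) -/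

/-- **STUB G · `stub_reflexWedgeGeometry`** — CLOSED (wave 1, p95759 + helpers p95634 Coord, p95688 B,
p95686 C; namespace `…MarginalWedge.ReflexGeometry`): `ReflexWedgeGeometry`. -/
theorem stub_reflexWedgeGeometry : ∀ (Λ : Finset HexVertex) (N : ℝ), 1 ≤ N → IsReflexWedgeTruncation Λ N → hexDomainSimplyConnected Λ ∧ cornerEdge ∈ hexDomainBoundary Λ ∧ (∀ v w : HexVertex, v ∈ Λ → w ∉ Λ → hexGraph.Adj v w → IsRayZeroDart N v w → hexCenter w - hexCenter v = ((Real.sqrt 3)⁻¹ : ℝ) * Complex.I ∧ ∀ γ : HexMidEdgeSAW Λ cornerEdge s(v, w), γ.winding = Real.pi) ∧ (∀ v w : HexVertex, v ∈ Λ → w ∉ Λ → hexGraph.Adj v w → IsRaySixtyDart N v w → hexCenter w - hexCenter v = ((Real.sqrt 3)⁻¹ : ℝ) * Complex.exp (-(Real.pi / 6) * Complex.I) ∧ ∀ γ : HexMidEdgeSAW Λ cornerEdge s(v, w), γ.winding = -(5 * Real.pi / 3)) :=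
  Summit.CriticalPhenomena.SAWScalingLimit.Theorems.HexConjecture.MarginalWedge.stub_reflexWedgeGeometry

/-- **STUB 1 · `stub_reflexFluxLine`** — CLOSED (wave 1, p88297; namespace `…MarginalWedge.FluxLine`):
`ReflexWedgeGeometry → ReflexFluxLine`. -/
theorem stub_reflexFluxLine : (∀ (Λ : Finset HexVertex) (N : ℝ), 1 ≤ N → IsReflexWedgeTruncation Λ N → hexDomainSimplyConnected Λ ∧ cornerEdge ∈ hexDomainBoundary Λ ∧ (∀ v w : HexVertex, v ∈ Λ → w ∉ Λ → hexGraph.Adj v w → IsRayZeroDart N v w → hexCenter w - hexCenter v = ((Real.sqrt 3)⁻¹ : ℝ) * Complex.I ∧ ∀ γ : HexMidEdgeSAW Λ cornerEdge s(v, w), γ.winding = Real.pi) ∧ (∀ v w : HexVertex, v ∈ Λ → w ∉ Λ → hexGraph.Adj v w → IsRaySixtyDart N v w → hexCenter w - hexCenter v = ((Real.sqrt 3)⁻¹ : ℝ) * Complex.exp (-(Real.pi / 6) * Complex.I) ∧ ∀ γ : HexMidEdgeSAW Λ cornerEdge s(v, w), γ.winding = -(5 * Real.pi / 3))) → ∀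 (Λ : Finset HexVertex) (N : ℝ), 1 ≤ N → IsReflexWedgeTruncation Λ N → farFlux Λ N = (1 / (2 * Real.sqrt 3) : ℂ) * (-Complex.I - Complex.exp (-Complex.I * (Real.pi / 8)) * ((rayZeroMass Λ N - raySixtyMass Λ N : ℝ) : ℂ)) :=
  Summit.CriticalPhenomena.SAWScalingLimit.Theorems.HexConjecture.MarginalWedge.stub_reflexFluxLine

/-- **STUB 2 · `stub_coneExteriorEscape`** — CLOSED (wave 1, p88075; namespace `…MarginalWedge.Escape`):
`ReflexFluxLine → ConeExteriorEscape`. -/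
theorem stub_coneExteriorEscape : (∀ (Λ : Finset HexVertex) (N : ℝ), 1 ≤ N → IsReflexWedgeTruncation Λ N → farFlux Λ N = (1 / (2 * Real.sqrt 3) : ℂ) * (-Complex.I - Complex.exp (-Complex.I * (Real.pi / 8)) * ((rayZeroMass Λ N - raySixtyMass Λ N : ℝ) : ℂ))) → ∀ (Λ Λ' : Finset HexVertex) (N : ℝ), 1 ≤ N → IsReflexWedgeTruncation Λ N → Λ ⊆ Λ' → Real.cos (Real.pi / 8) ≤ dartSum Λ (IsArcDart N) fun v w => Zm Λ' cornerEdge s(v, w) :=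
  Summit.CriticalPhenomena.SAWScalingLimit.Theorems.HexConjecture.MarginalWedge.stub_coneExteriorEscape

/-- **STUB P · `stub_arcPhases`** — CLOSED (wave 2; parts `…ArcPhasesCut` (cut-ray bookkeeping), `…ArcPhasesBound`
(`arcPhase_bound`), final `…ArcPhases`; namespace `…MarginalWedge.ArcPhase`; Hopf evaluation
`W = arg(w̄(c_w − c_v)) − arg(w̄(c_w − o)) + arg(ō(o − c_w)) − π/3`, `o = c_cornerOut`, `W ∈ [−4π/3, 2π/3]`): `ArcPhases`. -/
theorem stub_arcPhases : ∀ (Λ : Finset HexVertex) (N : ℝ), 1 ≤ N → IsReflexWedgeTruncation Λ N → ∀ v w : HexVertex, v ∈ Λ → w ∉ Λ → hexGraph.Adj v w → IsArcDart N v w → ∃ θ : ℝ, -(11 * Real.pi / 6) ≤ θ ∧ θ ≤ Real.pi / 6 ∧ hexCenter w - hexCenter v = ((Real.sqrt 3)⁻¹ : ℝ) * Complex.exp (θ * Complex.I) ∧ ∀ γ : HexMidEdgeSAW Λ cornerEdge s(v, w), γ.winding = θ + Real.pi / 2 :=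
  Summit.CriticalPhenomena.SAWScalingLimit.Theorems.HexConjecture.MarginalWedge.stub_arcPhases

/-- **STUB R · `stub_rayCeiling`** (L–XL, OPEN — reshape 2, the ray half of the old stub 3; kit-tested by
jobs j016180–j016184) — `RayCeiling`. A violation (`Z₀ + Z₆₀` growing faster than `log N`, or — see
`rayMassDiff_le_of_arcPhases` — impossible divergence of `Z₀ − Z₆₀`) kills the "dimensionless cell"
reading and with it stub 4's mechanism. -/
theorem stub_rayCeiling : ∃ C : ℝ, ∀ (Λ : Finset HexVertex) (N : ℝ), 1 ≤ N → IsReflexWedgeTruncation Λ N → (dartSum Λ (IsRayZeroDart N) fun v w => Zm Λ cornerEdge s(v, w)) + (dartSum Λ (IsRaySixtyDart N) fun v w => Zm Λ cornerEdge s(v, w)) ≤ C * (1 + Real.log N) := by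
  sorry

/-- **STUB 4 · `stub_traversalBound_of_reflexCell`** (XL, HARDEST, OPEN — the line's bet; the lead holds
it; registered signature unchanged) — `ConeExteriorEscape → ReflexCellCeiling → HexTraversalBound`.
Intended mechanism: (i) exact two-sided Gibbs conditioning / reversal reduces `k` traversals of
`D(x; ρ, R)` to a dyadic chain of ONE-SCALE dive ratios for arcs between boundary mid-edges of sub-domains
containing a virgin lattice disc (the `DiveRecursion`/`OneScaleDive` shape of crux `HexTight`'s line
`reversal-virgin-disc`, `SAWDevelopingMapHexTightDiveRecursion.lean`); (ii) the one-scale ratio is bounded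
by `q < 1` using, at the rim root, the scale-free FLOOR (stub 2, transported by lattice isometries and
restriction monotonicity) against the CEILING; (iii) `q^m` over `m` dyadic scales. Step (ii) is the bet:
no duality at `n = 0` turns an un-normalised corner floor into a ratio bound at rim roots. -/
theorem stub_traversalBound_of_reflexCell : (∀ (Λ Λ' : Finset HexVertex) (N : ℝ), 1 ≤ N → IsReflexWedgeTruncation Λ N → Λ ⊆ Λ' → Real.cos (Real.pi / 8) ≤ dartSum Λ (IsArcDart N) fun v w => Zm Λ' cornerEdge s(v, w)) → (∃ C : ℝ, ∀ (Λ : Finset HexVertex) (N : ℝ), 1 ≤ N → IsReflexWedgeTruncation Λ N → (dartSum Λ (IsArcDart N) fun v w => Zm Λ cornerEdge s(v, w)) ≤ C ∧ (dartSum Λ (IsRayZeroDart N) fun v w => Zm Λ cornerEdge s(v, w)) + (dartSum Λ (IsRaySixtyDart N) fun v w => Zm Λ cornerEdge s(v, w)) ≤ C * (1 + Real.log N)) → ∀ (D : DobrushinDomain) (a b : ℝ → HexVertex), IsEmbEndpointApprox hexGraph hexCenter D a b → ∃ (k : ℂ → ℝ → ℝ → ℕ) (K lam δ₀ : ℝ),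 0 ≤ K ∧ 2 < lam ∧ 0 < δ₀ ∧ ∀ δ ∈ Set.Ioc (0 : ℝ) δ₀, ∀ (x : ℂ) (ρ R : ℝ), δ ≤ ρ → ρ < R → R ≤ 1 → hexSAWLaw D.carrier δ (a δ) (b δ) {γ | (hexPolyline γ).HasTraversals (k x ρ R) x ρ R} ≤ ENNReal.ofReal (K * (ρ / R) ^ lam) := by
  sorry

/-- **STUB 5 · `stub_hexTight_of_traversalBound`** — CLOSED (wave 1, p88241; namespace
`…MarginalWedge.Tight`, (H0) cutoff 487): `HexTraversalBound → HexTight`. -/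
theorem stub_hexTight_of_traversalBound : (∀ (D : DobrushinDomain) (a b : ℝ → HexVertex), IsEmbEndpointApprox hexGraph hexCenter D a b → ∃ (k : ℂ → ℝ → ℝ → ℕ) (K lam δ₀ : ℝ), 0 ≤ K ∧ 2 < lam ∧ 0 < δ₀ ∧ ∀ δ ∈ Set.Ioc (0 : ℝ) δ₀, ∀ (x : ℂ) (ρ R : ℝ), δ ≤ ρ → ρ < R → R ≤ 1 → hexSAWLaw D.carrier δ (a δ) (b δ) {γ | (hexPolyline γ).HasTraversals (k x ρ R) x ρ R} ≤ ENNReal.ofReal (K * (ρ / R) ^ lam)) → Summit.CriticalPhenomena.SAWScalingLimit.Theses.SAWDevelopingMap.HexTight :=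
  Summit.CriticalPhenomena.SAWScalingLimit.Theorems.HexConjecture.MarginalWedge.stub_hexTight_of_traversalBound

/-- **STUB 6 · `stub_identification_of_tight`** (XL, OPEN; NOT attacked by this line — the I-half,
crux-sized; wave-1 verdict: `stub-blocked` on `Theses.SAWDefectDecoherence.HexObservableLimitR` (stmt-14003)
+ `ObservableToSLER` (stmt-14005) / `Theses.SAWDevelopingMap.ObservableToSLE` (stmt-10472), all OPEN; the
stub is equivalent to `HexTight → HexConjecture` (`hexConjecture_iff_tight_and_identification`); the lead's
`promote-stub` candidate) — `HexTight → HexIdentification`. -/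
theorem stub_identification_of_tight : Summit.CriticalPhenomena.SAWScalingLimit.Theses.SAWDevelopingMap.HexTight → ∀ (D : DobrushinDomain) (a b : ℝ → HexVertex), IsEmbEndpointApprox hexGraph hexCenter D a b → ∀ μ : Measure (CurveClass ℂ), IsProbabilityMeasure μ → IsSubseqLimitLaw (fun δ (γ : HexDomainSAW D.carrier δ (a δ) (b δ)) => γ.curve) (fun δ => hexSAWLaw D.carrier δ (a δ) (b δ)) μ → IsSLELaw ((8 : ℝ≥0) / 3) D μ := by
  sorry

/-! ## Consistency: each named statement IS its stub (definitionally), and the derived ceiling -/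

theorem reflexWedgeGeometry_holds : ReflexWedgeGeometry := stub_reflexWedgeGeometry
theorem reflexFluxLine_holds : ReflexWedgeGeometry → ReflexFluxLine := stub_reflexFluxLine
theorem coneExteriorEscape_holds : ReflexFluxLine → ConeExteriorEscape := stub_coneExteriorEscape
theorem arcPhases_holds : ArcPhases := stub_arcPhases
theorem rayCeiling_holds : RayCeiling := stub_rayCeiling
theorem traversalBound_holds : ConeExteriorEscape → ReflexCellCeiling → HexTraversalBound :=
  stub_traversalBound_of_reflexCell
theorem hexTight_holds : HexTraversalBound → HexTight := stub_hexTight_of_traversalBound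
theorem identification_holds : HexTight → HexIdentification := stub_identification_of_tight

/-- **The ceiling, DERIVED** (reshape 2; sorry-free glue): the flux line (closed stubs G, 1) and the arc
phases give the arc half `Σ_arc Zm ≤ 1 + √2` by the landed `arcMass_le_of_arcPhases` (p87487); the ray half
is `RayCeiling`; `C := max (1 + √2) C_ray` serves both since `0 ≤ log N` for `N ≥ 1`. -/
theorem reflexCellCeiling_of (hF : ReflexFluxLine) (hP : ArcPhases) (hR : RayCeiling) : ReflexCellCeiling := by
  obtain ⟨C, hC⟩ := hR
  refine ⟨max (1 + Real.sqrt 2) C, fun Λ N hN hΛ => ⟨?_, ?_⟩⟩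
  · exact (arcMass_le_of_arcPhases Λ N (hF Λ N hN hΛ) (hP Λ N hN hΛ)).trans (le_max_left _ _)
  · have hlog : 0 ≤ 1 + Real.log N := by linarith [Real.log_nonneg hN]
    exact (hC Λ N hN hΛ).trans (mul_le_mul_of_nonneg_right (le_max_right _ _) hlog)

/-- The registered name of the old stub 3, now a THEOREM modulo the two new stubs (kept so that the
registered composition below is unchanged in shape). -/
theorem reflexCellCeiling_holds : ReflexCellCeiling :=
  reflexCellCeiling_of (reflexFluxLine_holds reflexWedgeGeometry_holds) arcPhases_holds rayCeiling_holds

/-- **THE DIMENSIONLESS MARGINAL CELL** (the line's two-sided "RSW cell", arc part; now UNCONDITIONAL — all inputs landed):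
for every `N ≥ 1`, `cos(π/8) ≤ Σ_{arc darts of W_N} Z_{W_N}(a → z) ≤ 1 + √2`. Numerics: the arc mass is `1.06–1.11` for
`N ≤ 32` (`Lines/marginal_reflex_wedge_cauchy_kernel_numerics.md`). -/
theorem arcMass_mem_Icc (Λ : Finset HexVertex) (N : ℝ) (hN : 1 ≤ N) (hΛ : IsReflexWedgeTruncation Λ N) :
    Real.cos (Real.pi / 8) ≤ (dartSum Λ (IsArcDart N) fun v w => Zm Λ cornerEdge s(v, w)) ∧
      (dartSum Λ (IsArcDart N) fun v w => Zm Λ cornerEdge s(v, w)) ≤ 1 + Real.sqrt 2 :=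
  ⟨coneExteriorEscape_holds (reflexFluxLine_holds reflexWedgeGeometry_holds) Λ Λ N hN hΛ le_rfl,
    arcMass_le_of_arcPhases Λ N (reflexFluxLine_holds reflexWedgeGeometry_holds Λ N hN hΛ)
      (arcPhases_holds Λ N hN hΛ)⟩

/-- **The ray difference is bounded** (unconditional): `|Z₀ − Z₆₀ − sin(π/8)| ≤ 1 + √2` for every `N ≥ 1`
(landed `rayMassDiff_le_of_arcPhases`, p89485, + the flux line + the arc phases). Numerics: `Z₀ − Z₆₀` saturates near
`sin(π/8)` while `Z₀ + Z₆₀ = 0.366·ln N`. -/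
theorem rayMassDiff_le (Λ : Finset HexVertex) (N : ℝ) (hN : 1 ≤ N) (hΛ : IsReflexWedgeTruncation Λ N) :
    |rayZeroMass Λ N - raySixtyMass Λ N - Real.sin (Real.pi / 8)| ≤ 1 + Real.sqrt 2 :=
  rayMassDiff_le_of_arcPhases Λ N (reflexFluxLine_holds reflexWedgeGeometry_holds Λ N hN hΛ) (arcPhases_holds Λ N hN hΛ)

/-! ## Composition (sorry-free): the stubs prove the crux BY NAME -/

/-- The SHAPE of the line as one proposition: the eight stub statements (four closed, four open), in order,
imply the crux. -/
def LineShape : Prop :=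
  ReflexWedgeGeometry → (ReflexWedgeGeometry → ReflexFluxLine) → (ReflexFluxLine → ConeExteriorEscape) →
    ArcPhases → RayCeiling → (ConeExteriorEscape → ReflexCellCeiling → HexTraversalBound) →
      (HexTraversalBound → HexTight) → (HexTight → HexIdentification) → HexConjecture

/-- **The kernel-checked composition** (pure logic plus the landed soft half and the landed arc reduction;
no `sorry`): geometry feeds the flux line, the flux line the floor; flux line + arc phases + ray ceiling give
the ceiling (`reflexCellCeiling_of`); floor and ceiling feed stub 4 (multi-traversal bound), stub 5 gives
`HexTight`, whose instance at `(D, a, b)` is tightness along the mesh; stub 6 identifies the subsequential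
limits; `convergesInLawToSLE_of_identification` concludes `ConvergesInLawToSLE (8/3) D`. -/
theorem lineShape_holds : LineShape := by
  intro hG h1 h2 hP hR h4 h5 h6 D a b hab
  have hF : ReflexFluxLine := h1 hG
  have hT : HexTight := h5 (h4 (h2 hF) (reflexCellCeiling_of hF hP hR))
  exact convergesInLawToSLE_of_identification hab (hT D a b hab) (h6 hT D a b hab)

/-- **`HexConjecture` from the registered stubs** — the skeleton theorem audited by `ledger skeleton check`:
concludes the route decl `Theses.SAWDevelopingMap.HexConjecture` BY NAME; `sorry` enters only through the
four open `stub_*` declarations (`stub_arcPhases`, `stub_rayCeiling`, `stub_traversalBound_of_reflexCell`,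
`stub_identification_of_tight`). -/
theorem HexConjecture_of : HexConjecture :=
  lineShape_holds stub_reflexWedgeGeometry stub_reflexFluxLine stub_coneExteriorEscape stub_arcPhases
    stub_rayCeiling stub_traversalBound_of_reflexCell stub_hexTight_of_traversalBound
    stub_identification_of_tight

/-- The same skeleton theorem for `SAWHexUniversality.HexConjecture` (identical statement text; the
decl the item's first `wanted_by` names). -/
theorem HexConjecture_of' :
    Summit.CriticalPhenomena.SAWScalingLimit.Theses.SAWHexUniversality.HexConjecture :=
  HexConjecture_of

/-- The same skeleton theorem for `SAWBrickWallHomotopy.HexConjecture` (identical statement text). -/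
theorem HexConjecture_of'' :
    Summit.CriticalPhenomena.SAWScalingLimit.Theses.SAWBrickWallHomotopy.HexConjecture :=
  HexConjecture_of

end Summit.CriticalPhenomena.SAWScalingLimit.Cruxes.HexConjecture.MarginalReflexWedgeCauchyKernel

end
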